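import Summits.Ventures.Crystal3D.Theorems.StickyWulffConstantCoaxialWallLawTailResidueDefsL
import Summits.Ventures.Crystal3D.Theorems.StickyWulffConstantCoaxialWallLawTailResidueClosing2
import HarnessLib

/-!
# The lane-F closing theorem on the (position-based) LENS TYPES: `… → LensCert (2√6) → LensSoundness → CoaxialWallLaw`
# (crux `CoaxialWallLaw`, stmt-Ventures-19481; cf-p1 DECISION (cxi)(c): Closing2 re-instantiated on `…TailResidueDefsL`)

HONEST FRAMING. Venture `Summits/Ventures/Crystal3D` (cell `crystal3d-full`); helper `--supports` the crux `CoaxialWallLaw`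
(stmt-Ventures-19481, `route-Ventures-StickyWulffConstant`), registered line 'CoaxialWallLawCertificates' (planner cf-p1).  Rung credit;
F-C1 NOT moved.  `…TailResidueClosing2` (p694751) closed the crux by name on `TailResidueCert₂ ∧ TailTypeSoundness₂`; (cxi) demoted
`TailResidueCert₂` (its functional over-credits loose fillers) and made credit-free LENS TYPES the repair of record; the type language of record is the POSITION-BASED
`LensType` of `…TailResidueDefsL` (functional `LensType.row` = `localSummandFlatDecL`, pools `≥ 1`; the host-based `ResidueType₃` texts of
`…TailResidueDefs3` are superseded, see that file's docstring in `…DefsL`).  This file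
is the same one-screen composition on the new names:
* `endRowJointTailA_of_lensCert`, `endRowJointA_of_lensCertificates`, `coaxialWallLaw_of_lensCertificates`;
* **`coaxialWallLaw_of_lensCertificates_explicit : KissingGap (5/2) → KissingClassification (5/2) → StarPairFar → P5Exhaustion →
  EndRowOnSiteFlatA v2 (9/2) 𝒰_cx → EndRowOnSiteJointFlatA v2 (2√6) 𝒰_cx → LensCert (2√6) → LensSoundness → CoaxialWallLaw`**
  — the census-free cone for the re-registration 'Certificates3' (`stub_lensCert : LensCert (2√6)`, `stub_lensSound : LensSoundness`).
REMAINING BY-NAME DEBTS: `P5Exhaustion`; the two on-site flats [certified, bnb-ucx ×2 / 'jointrow']; `LensCert (2√6)` [cf-p2 §69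
re-based on DefsL]; `LensSoundness` [T4].  WHAT THIS IS NOT: not the certificates, not T4; F-C1 not moved.
-/

noncomputable section

namespace Summit.Ventures.Crystal3D.Theorems

open Summit.Ventures.Crystal3D Finset TailResidue
open scoped InnerProductSpace

/-- **The joint tail from the certificates and type soundness (L)** (line `s`). -/
theorem endRowJointTailA_of_lensCert {s : ℝ} (honT : EndRowOnSiteFlatA WordVersion.v2 s coaxialModuleUniverse)
    (honJ : EndRowOnSiteJointFlatA WordVersion.v2 s coaxialModuleUniverse) (hcert : LensCert s)
    (hsound : LensSoundness) : EndRowJointTailA WordVersion.v2 s coaxialModuleUniverse :=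
  endRowJointTailA_of_residue honT honJ fun L X hX z hz hdeg hoff => by
    rcases hsound L X hX z hz hdeg hoff with h | ⟨τ, hwf, hre, L₀, hL₀, hle⟩
    · exact Or.inl h
    · exact Or.inr (hle.trans (hcert τ hwf hre L₀ hL₀))

/-- **T-F2's joint row by name (L)**: bnb-ucx at `9/2`, 'jointrow' at `2√6`, `LensCert (2√6)`, `LensSoundness`. -/
theorem endRowJointA_of_lensCertificates (honT : EndRowOnSiteFlatA WordVersion.v2 (9 / 2) coaxialModuleUniverse)
    (honJ : EndRowOnSiteJointFlatA WordVersion.v2 (2 * Real.sqrt 6) coaxialModuleUniverse)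
    (hcert : LensCert (2 * Real.sqrt 6)) (hsound : LensSoundness) : EndRowJointA WordVersion.v2 (2 * Real.sqrt 6) :=
  endRowJointA_v2_twoSqrtSix_cx honT honJ
    (endRowJointTailA_of_lensCert (endRowOnSiteFlatA_mono_const nine_halves_le_two_sqrt_six honT) honJ hcert hsound)

/-- **LANE F'S CRUX BY NAME (L): `P5Exhaustion → EndRowOnSiteFlatA v2 (9/2) 𝒰_cx → EndRowOnSiteJointFlatA v2 (2√6) 𝒰_cx →
LensCert (2√6) → LensSoundness → CoaxialWallLaw`.** -/
theorem coaxialWallLaw_of_lensCertificates (hE1 : P5Exhaustion)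
    (honT : EndRowOnSiteFlatA WordVersion.v2 (9 / 2) coaxialModuleUniverse)
    (honJ : EndRowOnSiteJointFlatA WordVersion.v2 (2 * Real.sqrt 6) coaxialModuleUniverse)
    (hcert : LensCert (2 * Real.sqrt 6)) (hsound : LensSoundness) :
    Summit.Ventures.Crystal3D.Theses.StickyWulffConstant.CoaxialWallLaw :=
  coaxialWallLaw_of_jointA_v2_twoSqrtSix hE1 (endRowJointA_of_lensCertificates honT honJ hcert hsound)

/-- **LANE F'S CRUX BY NAME (L), CENSUS-FREE CONE (for the re-registration 'Certificates3'):
`KissingGap (5/2) → KissingClassification (5/2) → StarPairFar → P5Exhaustion → EndRowOnSiteFlatA v2 (9/2) 𝒰_cx →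
EndRowOnSiteJointFlatA v2 (2√6) 𝒰_cx → LensCert (2√6) → LensSoundness → CoaxialWallLaw`.** -/
theorem coaxialWallLaw_of_lensCertificates_explicit (hg : KissingGap (5 / 2)) (hc : KissingClassification (5 / 2)) (hSP : StarPairFar)
    (hE1 : P5Exhaustion) (honT : EndRowOnSiteFlatA WordVersion.v2 (9 / 2) coaxialModuleUniverse)
    (honJ : EndRowOnSiteJointFlatA WordVersion.v2 (2 * Real.sqrt 6) coaxialModuleUniverse)
    (hcert : LensCert (2 * Real.sqrt 6)) (hsound : LensSoundness) :
    Summit.Ventures.Crystal3D.Theses.StickyWulffConstant.CoaxialWallLaw :=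
  coaxialWallLaw_of_jointA_explicit WordVersion.v2 hg hc two_sqrt_six_pos le_rfl
    (endRowJointA_of_lensCertificates honT honJ hcert hsound) hE1 hSP

end Summit.Ventures.Crystal3D.Theorems

end
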